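import Mathlib.FieldTheory.Galois.IsGaloisGroup
import Mathlib.NumberTheory.RamificationInertia.Galois
import Mathlib.NumberTheory.NumberField.Basic
import Mathlib.RingTheory.Frobenius
import Mathlib.RingTheory.RamificationInertia.Inertia
import Mathlib.RingTheory.Ideal.Quotient.HasFiniteQuotients
import Mathlib.RingTheory.Ideal.Int
import Mathlib.FieldTheory.Finite.Basic
import Mathlib.RingTheory.DedekindDomain.Ideal.Lemmas
import HarnessLib

/-!
# Degree-one primes of a fixed field, counted in the Galois group

Topic `Literature/NumberTheory/GaloisRepresentations`. Everything in this file is PROVED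
(no `sorry`, no named facts).

Let `L/ℚ` be a finite Galois extension of number fields with group `G` (any finite group `G`
with `[MulSemiringAction G L] [IsGaloisGroup G ℚ L]`, acting on `𝓞 L` through Mathlib's
`MulSemiringAction G (𝓞 L)`), `H ≤ G` a subgroup with fixed field `E` (`[IsGaloisGroup H E L]`),
and `p` a prime number such that every prime `Q` of `𝓞 L` above `p` has trivial inertia group
`I(Q) = Q.inertia G`. Fix `Q₀ ∣ p` and its arithmetic Frobenius `F ∈ G` (`IsArithFrobAt ℤ F Q₀`,
unique since `I(Q₀) = 1`). The main result is the classical count behind Frobenius' density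
theorem (the value at `F` of the permutation character of `G` on `G/H`):

* `Literature.NumberTheory.GaloisRepresentations.DegreeOnePrimes.card_mul_card_absNorm_eq_card_conj_mem` —
  `#H · #{I ⊆ 𝓞 E : N(I) = p} = #{g ∈ G : g F g⁻¹ ∈ H}`,

i.e. the number of ideals of `𝓞 E` of norm `p` (= primes of `E` above `p` of residue degree one,
`card_absNorm_eq_card_inertiaDeg_eq_one`) is the number of fixed points of `F` on `G/H`.
The left-hand side is the `p`-th coefficient `c_E(p)` of the Dedekind zeta function of `E`
(`Literature.NumberTheory.LFunctions.idealNormCount`, `Literature.NumberTheory.LFunctions.IdealNormCount`), which is how the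
count enters the proof of Frobenius' theorem (`FrobeniusDivisionTheorem`).

Proof (Hilbert's ramification theory, Neukirch I §9, in Mathlib's `IsGaloisGroup` language):
for `Q ∣ P' ∣ p` (`P'` a prime of `𝓞 E`) the Frobenius of `Q` lies in `H` iff `f(P'/p) = 1`
(`inertiaDeg_eq_one_of_isArithFrobAt_of_mem`: `x ^ p ≡ F x = x (mod P')` on `𝓞 E` forces
`#(𝓞 E / P') ≤ p`; `mem_of_isArithFrobAt_of_inertiaDeg_eq_one`: the decomposition groups of `Q`
in `H` and in `G` both have order `f(Q/P') = f(Q/p)`, Mathlib's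
`Ideal.card_stabilizer_eq_card_inertia_mul_finrank`); then one counts the primes of `𝓞 L`
above `p` whose Frobenius lies in `H` in two ways — along the transitive `G`-action
(`card_smul_eq_card_stabilizer_mul`, stabilisers of order `f`) and fibrewise over the primes
`P'` of `𝓞 E` (`inertiaDeg_mul_card_frob_mem`, fibres of size `#H / f` over the degree-one
`P'` by the fundamental identity for `L/E`).

## References

* J. Neukirch, *Algebraic Number Theory*, Grundlehren 322 (1999), Ch. I §9 (Hilbert's
  ramification theory: (9.1) transitivity, (9.4)–(9.6) decomposition and inertia groups,
  Frobenius). [NeukirchANT1999]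
* P. Stevenhagen, H. W. Lenstra, *Chebotarëv and his density theorem*, Math. Intelligencer 18
  (1996), §3 (Frobenius' theorem and the Frobenius substitution). [StevenhagenLenstra1996]
* G. Frobenius, *Über Beziehungen zwischen den Primidealen eines algebraischen Körpers und den
  Substitutionen seiner Gruppe*, Sitzungsber. Königl. Preuß. Akad. Wiss. Berlin (1896), 689–703.
-/

noncomputable section

open NumberField Ideal Polynomial
open scoped Pointwise

namespace Literature.NumberTheory.GaloisRepresentations

namespace DegreeOnePrimes

/-! ### Generalities: Frobenius at unramified primes, counting along orbits -/

section General

variable {R S G : Type*} [CommRing R] [CommRing S] [Algebra R S] [Group G]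
  [MulSemiringAction G S] [SMulCommClass G R S]

/-- At a prime with trivial inertia group the arithmetic Frobenius is unique (Frobenii at `Q`
form a coset of `I(Q)`, Mathlib `IsArithFrobAt.mul_inv_mem_inertia`).
Ref: Neukirch, *Algebraic Number Theory*, Ch. I §9, (9.6) and the definition following it.
[folklore] -/
theorem isArithFrobAt_unique {Q : Ideal S} {σ σ' : G} (h : IsArithFrobAt R σ Q)
    (h' : IsArithFrobAt R σ' Q) (hI : Q.inertia G = ⊥) : σ = σ' := by
  have := h.mul_inv_mem_inertia h'
  rw [hI, Subgroup.mem_bot] at this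
  exact mul_inv_eq_one.mp this

omit [SMulCommClass G R S] in
/-- Inertia groups of conjugate primes are conjugate: `τ ∈ I(g • Q) → g⁻¹ τ g ∈ I(Q)`.
Ref: Neukirch, *Algebraic Number Theory*, Ch. I §9, (9.4) and p. 56. [folklore] -/
theorem conj_mem_inertia_of_mem_inertia_smul {Q : Ideal S} {g τ : G}
    (hτ : τ ∈ (g • Q).inertia G) : g⁻¹ * τ * g ∈ Q.inertia G := by
  intro x
  have hx : τ • g • x - g • x ∈ g • Q := hτ (g • x)
  rw [Ideal.mem_pointwise_smul_iff_inv_smul_mem, smul_sub] at hx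
  simpa [mul_smul] using hx

omit [SMulCommClass G R S] in
/-- If the inertia group of `Q` is trivial, so is that of every conjugate `g • Q`.
Ref: Neukirch, *Algebraic Number Theory*, Ch. I §9, (9.4). [folklore] -/
theorem inertia_smul_eq_bot {Q : Ideal S} (hI : Q.inertia G = ⊥) (g : G) :
    (g • Q).inertia G = ⊥ := by
  rw [eq_bot_iff]
  intro τ hτ
  have h := conj_mem_inertia_of_mem_inertia_smul hτ
  rw [hI, Subgroup.mem_bot] at h
  rw [Subgroup.mem_bot]
  have : τ = g * (g⁻¹ * τ * g) * g⁻¹ := by group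
  rw [this, h, mul_one, mul_inv_cancel]

end General

section Orbit

variable {G X : Type*} [Group G] [MulAction G X]

/-- The elements moving `x` to `y = g₀ • x` are in bijection with the stabilizer of `x`
(`g ↦ g₀⁻¹ g`). [folklore] -/
def smulEqEquivStabilizer (x y : X) (g₀ : G) (h : g₀ • x = y) :
    {g : G // g • x = y} ≃ MulAction.stabilizer G x where
  toFun g := ⟨g₀⁻¹ * g, by rw [MulAction.mem_stabilizer_iff, mul_smul, g.2, ← h, inv_smul_smul]⟩
  invFun s := ⟨g₀ * s, by rw [mul_smul, MulAction.mem_stabilizer_iff.mp s.2, h]⟩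
  left_inv g := Subtype.ext (by simp)
  right_inv s := Subtype.ext (by simp)

/-- Unfolding lemma for `smulEqEquivStabilizer`. [folklore] -/
@[simp] theorem coe_smulEqEquivStabilizer (x y : X) (g₀ : G) (h : g₀ • x = y)
    (g : {g : G // g • x = y}) : (smulEqEquivStabilizer x y g₀ h g : G) = g₀⁻¹ * g := rfl

/-- **Counting along a transitive action.** For a predicate `c` on a finite transitive `G`-set
`X` and a base point `x`, the number of `g ∈ G` with `c (g • x)` is `#Stab(x) · #{y | c y}`
(the orbit map `g ↦ g • x` is `#Stab(x)`-to-one). [folklore] -/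
theorem card_smul_eq_card_stabilizer_mul [Finite G] [Finite X] [MulAction.IsPretransitive G X]
    (c : X → Prop) (x : X) :
    Nat.card {g : G // c (g • x)} =
      Nat.card (MulAction.stabilizer G x) * Nat.card {y : X // c y} := by
  classical
  letI := Fintype.ofFinite G
  letI := Fintype.ofFinite X
  rw [Nat.card_eq_fintype_card, Fintype.card_subtype, Nat.card_eq_fintype_card (α := {y // c y}),
    Fintype.card_subtype]
  rw [Finset.card_eq_sum_card_fiberwise (f := fun g : G ↦ g • x) (t := Finset.univ.filter c)]
  · have key : ∀ y ∈ Finset.univ.filter c,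
        ((Finset.univ.filter fun g : G ↦ c (g • x)).filter fun g ↦ g • x = y).card =
          Nat.card (MulAction.stabilizer G x) := by
      intro y hy
      rw [Finset.mem_filter] at hy
      obtain ⟨g₀, hg₀⟩ := MulAction.exists_smul_eq G x y
      rw [Finset.filter_filter]
      have : (Finset.univ.filter fun g : G ↦ c (g • x) ∧ g • x = y) =
          Finset.univ.filter fun g : G ↦ g • x = y := by
        refine Finset.filter_congr fun g _ ↦ ⟨fun h ↦ h.2, fun h ↦ ⟨?_, h⟩⟩
        rw [h]; exact hy.2
      rw [this, ← Fintype.card_subtype, ← Nat.card_eq_fintype_card]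
      exact Nat.card_congr (smulEqEquivStabilizer x y g₀ hg₀)
    rw [Finset.sum_congr rfl key, Finset.sum_const, smul_eq_mul, mul_comm]
  · intro g hg
    simp only [Finset.coe_filter, Finset.mem_univ, true_and, Set.mem_setOf_eq] at hg ⊢
    exact hg

end Orbit

/-! ### Primes above `p` in a Galois number field and in the fixed field of `H` -/

section NumberField

variable {L : Type*} [Field L] [NumberField L] {G : Type*} [Group G]
  [MulSemiringAction G L] [IsGaloisGroup G ℚ L]

variable (p : ℕ) [hp : Fact p.Prime]

local notation "𝔭" => (Ideal.span {(p : ℤ)} : Ideal ℤ)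

omit hp in
/-- For an ideal `Q` above `p`, `#(ℤ / Q ∩ ℤ) = p`. [folklore] -/
theorem card_int_quot_under {S : Type*} [CommRing S] (Q : Ideal S) [Q.LiesOver 𝔭] :
    Nat.card (ℤ ⧸ Q.under ℤ) = p := by
  rw [← over_def Q 𝔭]
  exact Int.card_ideal_quot p

omit hp in
/-- Arithmetic Frobenius above `p`, unfolded: `σ • x ≡ x ^ p (mod Q)` for all `x`.
Ref: Neukirch, *Algebraic Number Theory*, Ch. I §9, (9.6) ff. [folklore] -/
theorem isArithFrobAt_int_iff {S : Type*} [CommRing S] {M : Type*} [Monoid M]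
    [MulSemiringAction M S] [SMulCommClass M ℤ S] (σ : M) (Q : Ideal S) [Q.LiesOver 𝔭] :
    IsArithFrobAt ℤ σ Q ↔ ∀ x, σ • x - x ^ p ∈ Q := by
  simp only [IsArithFrobAt, AlgHom.IsArithFrobAt, card_int_quot_under p Q,
    MulSemiringAction.toAlgHom_apply]

variable (E : IntermediateField ℚ L)

/-- A prime of `𝓞 E` above `p` is maximal. [folklore] -/
theorem isMaximal_of_liesOver (P' : Ideal (𝓞 E)) [P'.IsPrime] [P'.LiesOver 𝔭] :
    P'.IsMaximal :=
  IsMaximal.of_liesOver_isMaximal P' 𝔭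

/-- A prime of `𝓞 E` above `p` has finite residue field. [folklore] -/
theorem finite_quot_of_liesOver (P' : Ideal (𝓞 E)) [P'.IsPrime] [P'.LiesOver 𝔭] :
    Finite (𝓞 E ⧸ P') := by
  refine Ring.HasFiniteQuotients.finiteQuotient ?_
  refine ne_bot_of_liesOver_of_ne_bot (p := 𝔭) ?_ P'
  simp [hp.out.ne_zero]

/-- `#(𝓞 E / P') = p ^ f(P'/p)` (Mathlib `Ideal.absNorm_eq_pow_inertiaDeg'`).
Ref: Neukirch, *Algebraic Number Theory*, Ch. I §8, (8.2) ff. [folklore] -/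
theorem card_quot_eq_pow_inertiaDeg (P' : Ideal (𝓞 E)) [P'.IsPrime] [P'.LiesOver 𝔭] :
    Nat.card (𝓞 E ⧸ P') = p ^ P'.inertiaDeg ℤ := by
  haveI := isMaximal_of_liesOver p E P'
  rw [← Submodule.cardQuot_apply, ← absNorm_apply, absNorm_eq_pow_inertiaDeg' P' hp.out,
    inertiaDeg'_eq_inertiaDeg]

/-- Ideals of `𝓞 E` of prime norm `p` are exactly the primes above `p` of residue degree one;
in particular `#{I ⊆ 𝓞 E : N(I) = p} = #{P' ∣ p : f(P'/p) = 1}`.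
Ref: Neukirch, *Algebraic Number Theory*, Ch. I §8, (8.2)–(8.3). [folklore] -/
theorem card_absNorm_eq_card_inertiaDeg_eq_one :
    Nat.card {I : Ideal (𝓞 E) // absNorm I = p} =
      Nat.card {P' : primesOver 𝔭 (𝓞 E) // P'.1.inertiaDeg ℤ = 1} := by
  have hpow : ∀ P' : Ideal (𝓞 E), P'.IsPrime → P'.LiesOver 𝔭 →
      absNorm P' = p ^ P'.inertiaDeg ℤ := by
    intro P' _ _
    haveI : P'.IsMaximal := IsMaximal.of_liesOver_isMaximal P' 𝔭
    rw [absNorm_eq_pow_inertiaDeg' P' hp.out, inertiaDeg'_eq_inertiaDeg]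
  refine Nat.card_congr ((Equiv.subtypeEquivRight fun I ↦ ?_).trans
    (Equiv.subtypeSubtypeEquivSubtypeExists (fun I : Ideal (𝓞 E) ↦ I ∈ primesOver 𝔭 (𝓞 E))
      (fun P' ↦ P'.1.inertiaDeg ℤ = 1)).symm)
  constructor
  · intro hI
    haveI hprime : I.IsPrime := isPrime_of_irreducible_absNorm (hI ▸ hp.out)
    haveI hover : I.LiesOver 𝔭 := by
      refine (liesOver_span_iff hprime.ne_top (Nat.prime_iff_prime_int.mp hp.out)).mpr ?_
      have := absNorm_mem I
      rwa [hI, ← map_natCast (algebraMap ℤ (𝓞 E))] at this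
    refine ⟨⟨hprime, hover⟩, ?_⟩
    have h := hpow I hprime hover
    rw [hI] at h
    have h1 : p ^ 1 = p ^ I.inertiaDeg ℤ := by rwa [pow_one]
    exact (Nat.pow_right_injective hp.out.two_le h1).symm
  · rintro ⟨⟨hprime, hover⟩, hf⟩
    rw [hpow I hprime hover, hf, pow_one]

variable (H : Subgroup G) [IsGaloisGroup H E L]

omit [IsGaloisGroup G ℚ L] in
/-- **Degree one from Frobenius.** If a Frobenius `σ` at `Q ∣ P' ∣ p` lies in `H = Gal(L/E)`,
then `f(P'/p) = 1`: every `x ∈ 𝓞 E` satisfies `x ^ p ≡ σ x = x (mod P')`, so the field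
`𝓞 E / P'` has at most `p` elements.
Ref: Neukirch, *Algebraic Number Theory*, Ch. I §9, (9.4)–(9.6). [folklore] -/
theorem inertiaDeg_eq_one_of_isArithFrobAt_of_mem (P' : Ideal (𝓞 E)) [P'.IsPrime]
    [P'.LiesOver 𝔭] (Q : Ideal (𝓞 L)) [Q.LiesOver P'] {σ : G}
    (hF : IsArithFrobAt ℤ σ Q) (hσ : σ ∈ H) : P'.inertiaDeg ℤ = 1 := by
  haveI := IsGaloisGroup.of_isFractionRing H (𝓞 E) (𝓞 L) E L
  haveI : Q.LiesOver 𝔭 := LiesOver.trans Q P' 𝔭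
  haveI := isMaximal_of_liesOver p E P'
  -- every `x ∈ 𝓞 E` satisfies `x ^ p ≡ x (mod P')`
  have h1 : ∀ x : 𝓞 E, x ^ p - x ∈ P' := by
    intro x
    have hfix : σ • (algebraMap (𝓞 E) (𝓞 L) x) = algebraMap (𝓞 E) (𝓞 L) x :=
      smul_algebraMap (⟨σ, hσ⟩ : H) x
    have h2 := (isArithFrobAt_int_iff p σ Q).mp hF (algebraMap (𝓞 E) (𝓞 L) x)
    rw [hfix, ← map_pow, ← map_sub] at h2
    have h3 : x - x ^ p ∈ P' := by
      have : x - x ^ p ∈ Q.under (𝓞 E) := Ideal.mem_comap.mpr h2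
      rwa [← over_def Q P'] at this
    simpa using P'.neg_mem h3
  -- hence `#(𝓞 E / P') ≤ p`
  letI := Ideal.Quotient.field P'
  haveI := finite_quot_of_liesOver p E P'
  letI := Fintype.ofFinite (𝓞 E ⧸ P')
  have hle : Nat.card (𝓞 E ⧸ P') ≤ p := by
    have hne : (X ^ p - X : (𝓞 E ⧸ P')[X]) ≠ 0 :=
      FiniteField.X_pow_card_sub_X_ne_zero _ hp.out.one_lt
    have hdeg := FiniteField.X_pow_card_sub_X_natDegree_eq (𝓞 E ⧸ P') hp.out.one_lt
    rw [Nat.card_eq_fintype_card, ← Finset.card_univ, ← hdeg]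
    refine Polynomial.card_le_degree_of_subset_roots fun z _ ↦ ?_
    rw [mem_roots hne, IsRoot, eval_sub, eval_pow, eval_X, sub_eq_zero]
    obtain ⟨x, rfl⟩ := Ideal.Quotient.mk_surjective z
    rw [← map_pow, Ideal.Quotient.eq]
    exact h1 x
  rw [card_quot_eq_pow_inertiaDeg p E P'] at hle
  have hpos : 0 < P'.inertiaDeg ℤ := inertiaDeg_pos P' ℤ
  have hle' : p ^ P'.inertiaDeg ℤ ≤ p ^ 1 := by rwa [pow_one]
  have := (Nat.pow_le_pow_iff_right hp.out.one_lt).mp hle'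
  omega

variable [Finite G]

/-- **Frobenius from degree one.** If `f(P'/p) = 1` and `Q ∣ P'` has trivial inertia group in
`G`, then every Frobenius `σ` at `Q` lies in `H = Gal(L/E)`: the decomposition groups of `Q`
in `H` and in `G` both have order `f(Q/P') = f(Q/p)` (Mathlib
`Ideal.card_stabilizer_eq_card_inertia_mul_finrank`), so they coincide, and `σ ∈ D_G(Q)`.
Ref: Neukirch, *Algebraic Number Theory*, Ch. I §9, (9.6). [folklore] -/
theorem mem_of_isArithFrobAt_of_inertiaDeg_eq_one (P' : Ideal (𝓞 E)) [P'.IsPrime]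
    [P'.LiesOver 𝔭] (Q : Ideal (𝓞 L)) [Q.IsPrime] [Q.LiesOver P'] (hI : Q.inertia G = ⊥)
    (hf : P'.inertiaDeg ℤ = 1) {σ : G} (hF : IsArithFrobAt ℤ σ Q) : σ ∈ H := by
  haveI := IsGaloisGroup.of_isFractionRing H (𝓞 E) (𝓞 L) E L
  haveI : Q.LiesOver 𝔭 := LiesOver.trans Q P' 𝔭
  have htower : Q.inertiaDeg ℤ = Q.inertiaDeg (𝓞 E) := by
    rw [inertiaDeg_tower P' Q, hf, one_mul]
  have hIH : Q.inertia H = ⊥ := by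
    rw [eq_bot_iff]
    intro h hh
    have : (h : G) ∈ Q.inertia G := fun x ↦ hh x
    rw [hI, Subgroup.mem_bot] at this
    rw [Subgroup.mem_bot]
    exact Subtype.ext this
  have hSG : Nat.card (MulAction.stabilizer G Q) = Q.inertiaDeg ℤ := by
    rw [card_stabilizer_eq_card_inertia_mul_finrank 𝔭 Q, hI, Subgroup.card_bot, one_mul]
  have hSH : Nat.card (MulAction.stabilizer H Q) = Q.inertiaDeg (𝓞 E) := by
    have e := card_stabilizer_eq_card_inertia_mul_finrank (G := H) P' Q
    rw [hIH, Subgroup.card_bot, one_mul] at e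
    exact e
  let ι : MulAction.stabilizer H Q → MulAction.stabilizer G Q := fun h ↦ ⟨(h.1 : G), h.2⟩
  have hι : Function.Injective ι := by
    intro a b hab
    exact Subtype.ext (Subtype.ext (congrArg (fun z : MulAction.stabilizer G Q ↦ (z : G)) hab))
  have hbij : Function.Bijective ι := by
    rw [Nat.bijective_iff_injective_and_card]
    exact ⟨hι, by rw [hSH, hSG, htower]⟩
  obtain ⟨h, hh⟩ := hbij.2 ⟨σ, hF.mem_stabilizer⟩
  have : (h.1 : G) = σ := congrArg (fun z : MulAction.stabilizer G Q ↦ (z : G)) hh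
  rw [← this]
  exact h.1.2

omit [IsGaloisGroup H E L] hp [Finite G] in
/-- The primes of `𝓞 L` above `p` lying over a given prime `P'` of `𝓞 E` above `p` are the
primes of `𝓞 L` above `P'`. [folklore] -/
def primesOverEquiv (P' : primesOver 𝔭 (𝓞 E)) :
    {Q : primesOver 𝔭 (𝓞 L) // Q.1.LiesOver P'.1} ≃ primesOver P'.1 (𝓞 L) where
  toFun Q := ⟨Q.1.1, Q.1.2.1, Q.2⟩
  invFun Q := ⟨⟨Q.1, Q.2.1, by haveI := Q.2.1; haveI := Q.2.2; exact LiesOver.trans Q.1 P'.1 𝔭⟩,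
    Q.2.2⟩
  left_inv _ := rfl
  right_inv _ := rfl

/-- **Counting over the primes of the fixed field.** With `f = f(Q₀/p)` the common residue
degree of the primes of `𝓞 L` above the prime `p` (all assumed to have trivial inertia):
`f · #{Q ∣ p in 𝓞 L : Frob(Q) ∈ H} = #H · #{P' ∣ p in 𝓞 E : f(P'/p) = 1}` — the primes `Q`
whose Frobenius lies in `H` are those above a degree-one `P'`, and there are `#H / f` of them
above each such `P'` (fundamental identity for `L/E`, Mathlib
`Ideal.ncard_primesOver_mul_card_inertia_mul_finrank`).
Ref: Neukirch, *Algebraic Number Theory*, Ch. I §9, (9.1)–(9.6). [folklore] -/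
theorem inertiaDeg_mul_card_frob_mem (Q₀ : Ideal (𝓞 L)) [Q₀.IsPrime] [Q₀.LiesOver 𝔭]
    (hunr : ∀ Q : Ideal (𝓞 L), Q.IsPrime → Q.LiesOver 𝔭 → Q.inertia G = ⊥) :
    Q₀.inertiaDeg ℤ *
        Nat.card {Q : primesOver 𝔭 (𝓞 L) // ∀ σ : G, IsArithFrobAt ℤ σ Q.1 → σ ∈ H} =
      Nat.card H * Nat.card {P' : primesOver 𝔭 (𝓞 E) // P'.1.inertiaDeg ℤ = 1} := by
  classical
  haveI := IsGaloisGroup.of_isFractionRing H (𝓞 E) (𝓞 L) E L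
  set f := Q₀.inertiaDeg ℤ with hfdef
  have hf : ∀ Q : primesOver 𝔭 (𝓞 L), Q.1.inertiaDeg ℤ = f := fun Q ↦
    inertiaDeg_eq_of_isGaloisGroup 𝔭 Q.1 Q₀ G
  -- the restriction map `u : Q ↦ Q ∩ 𝓞 E`
  let u : primesOver 𝔭 (𝓞 L) → primesOver 𝔭 (𝓞 E) := fun Q ↦
    ⟨Q.1.under (𝓞 E), inferInstance, inferInstance⟩
  have hu : ∀ (Q : primesOver 𝔭 (𝓞 L)) (P' : primesOver 𝔭 (𝓞 E)),
      u Q = P' ↔ Q.1.LiesOver P'.1 := by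
    intro Q P'
    rw [Subtype.ext_iff, liesOver_iff, eq_comm]
  -- size of a fibre of `u` over a degree-one prime
  have hfib : ∀ P' : primesOver 𝔭 (𝓞 E), P'.1.inertiaDeg ℤ = 1 →
      f * Nat.card {Q : primesOver 𝔭 (𝓞 L) // Q.1.LiesOver P'.1} = Nat.card H := by
    intro P' hP'
    obtain ⟨⟨Q, hQp, hQl⟩⟩ := (inferInstance : Nonempty (primesOver P'.1 (𝓞 L)))
    haveI : Q.LiesOver 𝔭 := LiesOver.trans Q P'.1 𝔭
    have hIH : Q.inertia H = ⊥ := by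
      rw [eq_bot_iff]
      intro h hh
      have : (h : G) ∈ Q.inertia G := fun x ↦ hh x
      rw [hunr Q hQp inferInstance, Subgroup.mem_bot] at this
      rw [Subgroup.mem_bot]
      exact Subtype.ext this
    have key := ncard_primesOver_mul_card_inertia_mul_finrank (G := H) P'.1 Q
    rw [hIH, Subgroup.card_bot, mul_one, ← Nat.card_coe_set_eq,
      ← Nat.card_congr (primesOverEquiv p E P')] at key
    have hfQ : Q.inertiaDeg (𝓞 E) = f := by
      have t := inertiaDeg_tower (R := ℤ) P'.1 Q
      rw [hP', one_mul] at t
      rw [← t]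
      exact hf ⟨Q, hQp, inferInstance⟩
    rw [hfQ] at key
    rw [mul_comm]
    exact key
  -- on the fibre of `u` over `P'`, "the Frobenius class of `Q` lies in `H`" iff `f(P'/p) = 1`
  have hc : ∀ (Q : primesOver 𝔭 (𝓞 L)) (P' : primesOver 𝔭 (𝓞 E)), u Q = P' →
      ((∀ σ : G, IsArithFrobAt ℤ σ Q.1 → σ ∈ H) ↔ P'.1.inertiaDeg ℤ = 1) := by
    intro Q P' hQP'
    haveI : Q.1.LiesOver P'.1 := (hu Q P').mp hQP'
    constructor
    · intro hcQ
      haveI : Finite (𝓞 L ⧸ Q.1) := by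
        refine Ring.HasFiniteQuotients.finiteQuotient ?_
        refine ne_bot_of_liesOver_of_ne_bot (p := 𝔭) ?_ Q.1
        simp [hp.out.ne_zero]
      obtain ⟨σ, hσ⟩ := IsArithFrobAt.exists_of_isInvariant ℤ G Q.1
      exact inertiaDeg_eq_one_of_isArithFrobAt_of_mem p E H P'.1 Q.1 hσ (hcQ σ hσ)
    · intro hP' σ hσ
      exact mem_of_isArithFrobAt_of_inertiaDeg_eq_one p E H P'.1 Q.1 (hunr Q.1 Q.2.1 Q.2.2)
        hP' hσ
  -- fibrewise count
  letI := Fintype.ofFinite H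
  rw [Nat.card_eq_fintype_card (α := {Q : primesOver 𝔭 (𝓞 L) // _}), Fintype.card_subtype,
    Finset.card_eq_sum_card_fiberwise (f := u) (t := (Finset.univ : Finset (primesOver 𝔭 (𝓞 E))))
      (fun _ _ ↦ Finset.mem_coe.mpr (Finset.mem_univ _)),
    Finset.mul_sum, Nat.card_eq_fintype_card (α := {P' : primesOver 𝔭 (𝓞 E) // _}),
    Fintype.card_subtype, Finset.card_eq_sum_ones, Finset.mul_sum, Finset.sum_filter]
  refine Finset.sum_congr rfl fun P' _ ↦ ?_
  by_cases hP' : P'.1.inertiaDeg ℤ = 1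
  · rw [if_pos hP', mul_one, ← hfib P' hP', Finset.filter_filter]
    congr 1
    rw [Nat.card_eq_fintype_card, Fintype.card_subtype]
    refine congrArg Finset.card (Finset.filter_congr fun Q _ ↦ ?_)
    rw [← hu Q P']
    exact ⟨fun h ↦ h.2, fun h ↦ ⟨(hc Q P' h).mpr hP', h⟩⟩
  · rw [if_neg hP', Finset.filter_filter]
    have : (Finset.univ.filter fun Q : primesOver 𝔭 (𝓞 L) ↦
        (∀ σ : G, IsArithFrobAt ℤ σ Q.1 → σ ∈ H) ∧ u Q = P') = ∅ :=
      Finset.filter_eq_empty_iff.mpr fun Q _ h ↦ hP' ((hc Q P' h.2).mp h.1)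
    rw [this, Finset.card_empty, mul_zero]

/-- **Degree-one primes of a fixed field, counted in the Galois group.** Let `L/ℚ` be Galois
with finite group `G`, `H ≤ G` with fixed field `E`, `p` a prime such that every prime of `𝓞 L`
above `p` has trivial inertia group, `Q₀ ∣ p` a prime of `𝓞 L` and `F ∈ G` its arithmetic
Frobenius. Then `#H · #{I ⊆ 𝓞 E : N(I) = p} = #{g ∈ G : g F g⁻¹ ∈ H}`: the number of
degree-one primes of `E` above `p` (= ideals of norm `p`) is the number of fixed points of `F`
on `G/H`, i.e. the value at the Frobenius class of `p` of the permutation character of `G` on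
`G/H` (the count underlying Frobenius' theorem of 1896).
Ref: Neukirch, *Algebraic Number Theory*, Ch. I §9; Stevenhagen–Lenstra, *Chebotarëv and his
density theorem* (1996), §3. [folklore] -/
theorem card_mul_card_absNorm_eq_card_conj_mem (Q₀ : Ideal (𝓞 L)) [Q₀.IsPrime]
    [Q₀.LiesOver 𝔭]
    (hunr : ∀ Q : Ideal (𝓞 L), Q.IsPrime → Q.LiesOver 𝔭 → Q.inertia G = ⊥)
    {F : G} (hF : IsArithFrobAt ℤ F Q₀) :
    Nat.card H * Nat.card {I : Ideal (𝓞 E) // absNorm I = p} =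
      Nat.card {g : G // g * F * g⁻¹ ∈ H} := by
  classical
  let P₀ : primesOver 𝔭 (𝓞 L) := ⟨Q₀, ‹_›, ‹_›⟩
  let c : primesOver 𝔭 (𝓞 L) → Prop := fun Q ↦ ∀ σ : G, IsArithFrobAt ℤ σ Q.1 → σ ∈ H
  -- Step 1: `g F g⁻¹` is *the* Frobenius of `g • Q₀`
  have h1 : Nat.card {g : G // g * F * g⁻¹ ∈ H} = Nat.card {g : G // c (g • P₀)} := by
    refine Nat.card_congr (Equiv.subtypeEquivRight fun g ↦ ?_)
    have hFg : IsArithFrobAt ℤ (g * F * g⁻¹) (g • P₀).1 := hF.conj g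
    constructor
    · intro hg σ hσ
      rwa [isArithFrobAt_unique hσ hFg (hunr _ (g • P₀).2.1 (g • P₀).2.2)]
    · intro hcg
      exact hcg _ hFg
  -- Step 2: count along the transitive action of `G` on the primes above `p`
  have h2 := card_smul_eq_card_stabilizer_mul (G := G) c P₀
  -- Step 3: the stabilizer (decomposition group) of `Q₀` has order `f = f(Q₀/p)`
  have h3 : Nat.card (MulAction.stabilizer G P₀) = Q₀.inertiaDeg ℤ := by
    have e : MulAction.stabilizer G P₀ = MulAction.stabilizer G Q₀ := by
      ext g
      simp only [MulAction.mem_stabilizer_iff, Subtype.ext_iff, coe_smul_primesOver, P₀]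
    rw [e, card_stabilizer_eq_card_inertia_mul_finrank 𝔭 Q₀, hunr Q₀ ‹_› ‹_›, Subgroup.card_bot,
      one_mul]
  -- Steps 4–5: count fibrewise over the primes of `𝓞 E`, and identify degree-one primes
  have h4 := inertiaDeg_mul_card_frob_mem p E H Q₀ hunr
  have h5 := card_absNorm_eq_card_inertiaDeg_eq_one p E
  rw [h1, h2, h3, h5, ← h4]

end NumberField

end DegreeOnePrimes

end Literature.NumberTheory.GaloisRepresentations
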